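import Mathlib
import Summits.Schanuel.Schanuel.Theses.RigidCore
import Summits.Schanuel.Schanuel.Theorems.AclSubsetLogFreeCore.Negative.LogFreeCoreObjects
import Summits.Schanuel.Schanuel.Theorems.AclSubsetLogFreeCore.Negative.AclSubsetLogFreeCoreIffReal
import Summits.Schanuel.Schanuel.Theorems.RigidCoreAclSubsetLogFreeCoreAclSubsetEclOfEac
import Summits.Schanuel.Schanuel.Theorems.RigidCoreAclSubsetLogFreeCoreCoreAutElementaryOfEac
import Summits.Schanuel.Schanuel.Theorems.RigidCoreAclSubsetLogFreeCoreOfEac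
import Literature.NumberTheory.Transcendental.ZilberField
import Literature.NumberTheory.Transcendental.ZilberFieldQuasiminimal
import Literature.NumberTheory.Transcendental.ZilberFieldAutomorphisms
import Literature.NumberTheory.Transcendental.GammaIsoCross
import Literature.NumberTheory.Transcendental.GammaFields
import Literature.NumberTheory.Transcendental.ZilberGenericClosedness
import Literature.NumberTheory.Transcendental.PseudoExpVariants

/-!
# Line `eac-extends-core-automorphisms` — skeleton for crux `RigidCore.AclSubsetLogFreeCore`
(stmt-Schanuel-0968), RESHAPED by lead prover-line-stmt-Schanuel-0968-1 (gen 1, 2026-08-16)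

## Status inherited from lead -0
* `stub_aclSubsetEcl_of_eac` — CLOSED p71976; `stub_coreAut_elementary_of_eac` — CLOSED p72100;
  transfer `(A) ⟸ EAC ∧ (A₀)` — LANDED p72771
  (`Summit.Schanuel.Schanuel.Theorems.RigidCore.aclSubsetLogFreeCore_of_eac_of_coreFixedField`);
  residue presentation-independence — LANDED p72560.
* the residue (A₀) `stub_coreFixedField_logFree` was handed back as crux-sized (`promote-stub`).

## The reshape (this lead): (A₀) under ZILBER'S CONJECTURE, split along the E/L/A structure of the core

The standing hypothesis is strengthened from EAC to `stub_zilber : IsZilberField ℂ` (Zilber's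
conjecture `ZilberConjecture`; it implies EAC, `IsStronglyExpAlgClosed.isExpAlgClosed`), because the
tree holds a complete engine for constructing core automorphisms of a Zilber field:
hull-to-closure `ZilberAutomorphisms.exists_isEIsoOn_of_isGammaIsoTw₂` (Kirby 2010 Thm 2.1, KMO 2012
§3.5), cross-field `ℵ₀`-saturation over `ℚτ` `ZilberSaturationLog.isGammaIsoTw₂_saturation_tau'`
(Bays–Kirby Lemma 8.3 for abstract extensions), the countable model `BKModel.exists_countable_seac_model`
over any finitely generated partial exponential field with standard kernel, and the Kummer fact
`BaysKirby2018_divisionSequences_determined_holds`.  Write `τ = 2πi`, `Λ₀ = ℚτ`, `C₀ = ecl ∅`,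
`C_EA = logFreeCore`, and `C_ELA` for the ELA-core (smallest subfield `∋ 2πi` closed under `exp`,
under logarithms and relatively algebraically closed; inlined `sInf` below).  (A₀) becomes

  (A₀) ⟸ ZC ∧ [Case I: core-fixed ⟹ `∈ C_ELA`] ∧ [Case II: core-fixed ∧ `∈ C_ELA` ⟹ `∈ C_EA`].

* Case I is a FREE-AMALGAM ("doubling") argument, provable now: the hull `W ∋ a` over `Λ₀` is free over
  its E/L/A-chain closure `U* ⊆ C_ELA`; an algebraically disjoint abstract copy of `W` over `U*` (a
  partial E-field with standard kernel built inside `ℂ` from a generic field embedding —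
  `stub_doubleBase`) is realised in `ℂ` by the countable model (`stub_doubleModel`) + cross
  saturation (`stub_realiseCopy`), giving a Γ-isomorphic partner `W'` of `W` over `U*` whose difference
  with `W` avoids `U*`; hull-to-core (`hullToCore`, proved below from the tree) turns `W ↦ W'` into a core
  automorphism moving every `a ∈ W ∖ U*` (`stub_caseI`).
* Case II is the ARITHMETIC of the free ELA-closure (Kummer): logarithms `s` of elements algebraic over a
  strong Γ-field shift, `s ↦ s + m·j·2πi` for all `j`, by Γ-isomorphisms (`stub_logShift`, from the Kummer
  fact); with hull-to-core these move everything that depends on a logarithm; the exp-of-algebraic step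
  is the remaining research content (`stub_caseII`, held by the lead).

Registered stubs: `stub_zilber` (OPEN, external), `stub_logShift`, `stub_doubleBase`,
`stub_doubleModel`, `stub_realiseCopy`, `stub_caseI` (provable now), `stub_caseII` (hardest, lead).
The composition `AclSubsetLogFreeCore_of` concludes the crux BY NAME; its only `sorry`s are the stubs'.

## Disproof used (`Cruxes/AclSubsetLogFreeCore/Disproof.lean`, gen 3, read 2026-08-16)
* §11 Targets: both residues irrefutable today, reduced to REAL elements by `conj` — consistent (our
  automorphisms fix `τ`, `conj` is the other coset).
* §7 `not_branchIndiscernibility` (Kummer parity): `stub_logShift` shifts by `m·j·τ` with `m` supplied by the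
  Kummer fact — never claims the shift by `τ` itself.
* §10 `CountableVariant`: finiteness enters through (A₀) being fed only pointwise-definable numbers (transfer
  p72771); no countable definable set is ever pushed into `C_EA`.
* `_false_without_expClosed` / `_without_period_and_exp`: the conclusion is membership in the genuine `C_EA`.
-/

noncomputable section

set_option linter.dupNamespace false

open FirstOrder FirstOrder.Language Set
open Literature.ModelTheory.ExponentialFields Literature.ModelTheory.ExponentialFields.ExponentialRing
open Literature.NumberTheory.Transcendental Literature.NumberTheory.Transcendental.GammaField
open Summit.Schanuel.Schanuel.Theorems.AclSubsetLogFreeCore.Negative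

namespace Summit.Schanuel.Schanuel.Cruxes.AclSubsetLogFreeCore.EacExtendsCoreAutomorphisms

/-! ## Registered stubs -/

/-- **Stub 1 — Zilber's conjecture for `ℂ_exp`** (`IsZilberField ℂ`: standard kernel, Schanuel
property, strong exponential-algebraic closedness, CCP).  OPEN; external (`ZilberConjecture`); it
implies the old standing hypothesis EAC.  The standing hypothesis of the reshaped line. -/
theorem stub_zilber : IsZilberField ℂ := by
  sorry

/-- **Stub 2 — logarithms shift (Kummer).**  If `exp d` is algebraic over the Γ-field
`ℚ(2πiℚ, c, exp(ℚ·2πi + ℚc))` of `Λ₀ + ℚc` but `d` is not, then for some `m ≥ 1` and EVERY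
`j ∈ ℤ`, `(c, d) ↦ (c, d + m j·2πi)` is a Γ-isomorphism over the identity of `ℚ^{ab}(2πi)`
(all Kummer levels at once).  Provable now (M/L): the Kummer fact
`Literature.FieldTheory.Kummer.BaysKirby2018_divisionSequences_determined_holds` applied to
`b = exp` of a basis of `ℚ·2πi + ℚc` modulo `ℚ·2πi` and `c₀ = exp d` gives `m`; the two division
systems `exp (d/(mk))` and `exp ((d + m j·2πi)/(mk)) = exp (d/(mk))·ζ_k^j` below `exp (d/m)` are
conjugate over `L = E(exp (d/m))`, `E` the Γ-field of `Λ₀ + ℚc` at all levels; `d`, `d + m j·2πi`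
are transcendental over `L(all roots)`, so the conjugation extends by `d ↦ d + m j·2πi`; conclude with
`GammaField.isGammaIsoTw₂_of_ringHom`. (Disproof §7: the shift is by `m·j·2πi`, not by `2πi`.) -/
theorem stub_logShift (τ : ℂ) (hτ : τ = 2 * ↑Real.pi * Complex.I) {N : ℕ} (c : Fin N → ℂ) (d : ℂ)
    (hexp : Complex.exp d ∈ acl (gens (Submodule.span ℚ ({τ} : Set ℂ) ⊔
      Submodule.span ℚ (range c))))
    (hd : d ∉ acl (gens (Submodule.span ℚ ({τ} : Set ℂ) ⊔
      Submodule.span ℚ (range c)))) :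
    ∃ m : ℕ, 0 < m ∧ ∀ j : ℤ,
      IsGammaIsoTw₂ (RingEquiv.refl (fieldOf (Submodule.span ℚ ({τ} : Set ℂ))))
        (Fin.snoc c d) (Fin.snoc c (d + (m : ℂ) * (j : ℂ) * τ)) := by
  sorry

/-- **Stub 3 — the double, base half (free amalgam of a free strong extension with itself, as a
finitely generated partial exponential field with standard kernel).**  Let `X = ℚ·τ + ℚc ◁ ℂ`
(`τ = 2πi`) and `e` a tuple, `ℚ`-linearly independent over `X`, which is FREE over `X` (no
non-trivial `ℤ`-combination of `e`, nor its exponential, is algebraic over the Γ-field `ℚ(gens X)`);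
put `W = X + ℚe`.  Then there are: a subfield `F ⊆ ℂ` containing `W` and all division points
`exp (x/M!)`, `x ∈ W`; a field `K` with a finite-dimensional `ℚ`-subspace `D`, a partial exponential
`θ` and `t ∈ D` forming an `IsStdKernelPartialExpField`; and two field embeddings `j₁ j₂ : F → K`
("the two copies of `W`") which agree on the generators of the Γ-field of `X` and send `τ ↦ t`,
such that `D` is spanned by `j₁(W) ∪ j₂(W)`, `θ` extends `exp` along both copies, the first copy is
STRONG inside the partial E-field `(K, D, θ)` (predimension inequality for every intermediate
subspace, stated with the algebraic matroid of `K`), and the copies are in general position: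
`Σ qⱼ (j₂ eⱼ − j₁ eⱼ) ∉ ℚt + ℚ j₁(c)` for `q ≠ 0`.  Provable now (XL): with `L = acl (gens X)`
(relatively algebraically closed, countable) and `F = ℚ(L ∪ allGens (c, e))`-type countable field,
take a GENERIC EMBEDDING `φ : F → ℂ` over `L` (send a transcendence basis of `F/L` to elements
chosen successively outside the algebraic closure of `F` — `ℂ` has uncountable transcendence degree —
and extend by `IsAlgClosed.lift`, cf. `BKModel.exists_algHom_of_isTranscendenceBasis`); then
`F ∩ φ(F) = L`, `W ∩ φ(W) = X` (freeness), `D = W + φ(W) = X ⊕ ℚe ⊕ ℚφ(e)` carries the well-defined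
homomorphism `θ = exp` on `W`, `θ = φ ∘ exp ∘ φ⁻¹` on `φ(W)`, whose kernel on `D` is `ℤτ` because `X`
is log-closed in `W` (freeness again); `K = ℚ(D ∪ θ D) ⊆ ℂ`, `j₁ = incl`, `j₂ = φ` (template:
`Literature.Barriers.Schanuel.exists_isStdKernelPartialExpField`); strongness of the first copy
inside `(K, D, θ)` is `X ◁ ℂ` transported by `φ` plus algebraic disjointness of `φ(F)` from `F` over `L`. -/
theorem stub_doubleBase (τ : ℂ) (hτ : τ = 2 * ↑Real.pi * Complex.I)
    {N k : ℕ} (c : Fin N → ℂ) (e : Fin k → ℂ)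
    (hX : IsStrong (Submodule.span ℚ ({τ} : Set ℂ) ⊔ Submodule.span ℚ (range c)))
    (hlin : LinIndepOver (Submodule.span ℚ ({τ} : Set ℂ) ⊔ Submodule.span ℚ (range c)) e)
    (hfree : ∀ m : Fin k → ℤ, m ≠ 0 →
      (∑ j, (m j : ℚ) • e j) ∉ acl (gens (Submodule.span ℚ ({τ} : Set ℂ) ⊔ Submodule.span ℚ (range c))) ∧
      Complex.exp (∑ j, (m j : ℚ) • e j) ∉ acl (gens (Submodule.span ℚ ({τ} : Set ℂ) ⊔
        Submodule.span ℚ (range c)))) :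
    ∃ (F : IntermediateField ℚ ℂ)
      (_ : ∀ x ∈ Submodule.span ℚ ({τ} : Set ℂ) ⊔ Submodule.span ℚ (range (Fin.append c e)),
        x ∈ F ∧ ∀ M : ℕ, Complex.exp (x / (M.factorial : ℂ)) ∈ F)
      (K : Type) (_ : Field K) (_ : CharZero K) (D : Submodule ℚ K) (θ : K → K) (t : K)
      (j₁ j₂ : F →+* K),
      IsStdKernelPartialExpField K D θ t ∧
      (∀ hτF : τ ∈ F, j₁ ⟨τ, hτF⟩ = t ∧ j₂ ⟨τ, hτF⟩ = t) ∧
      (∀ (x : ℂ) (hxF : x ∈ F),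
        (x ∈ Submodule.span ℚ ({τ} : Set ℂ) ⊔ Submodule.span ℚ (range c) ∨
          ∃ y ∈ Submodule.span ℚ ({τ} : Set ℂ) ⊔ Submodule.span ℚ (range c), ∃ M : ℕ,
            x = Complex.exp (y / (M.factorial : ℂ))) →
        j₁ ⟨x, hxF⟩ = j₂ ⟨x, hxF⟩) ∧
      D = Submodule.span ℚ
        ((fun x : F => j₁ x) '' {x : F | (x : ℂ) ∈ Submodule.span ℚ ({τ} : Set ℂ) ⊔
            Submodule.span ℚ (range (Fin.append c e))} ∪
          (fun x : F => j₂ x) '' {x : F | (x : ℂ) ∈ Submodule.span ℚ ({τ} : Set ℂ) ⊔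
            Submodule.span ℚ (range (Fin.append c e))}) ∧
      (∀ (x : ℂ) (hxF : x ∈ F) (hexF : Complex.exp x ∈ F),
        x ∈ Submodule.span ℚ ({τ} : Set ℂ) ⊔ Submodule.span ℚ (range (Fin.append c e)) →
        θ (j₁ ⟨x, hxF⟩) = j₁ ⟨Complex.exp x, hexF⟩ ∧ θ (j₂ ⟨x, hxF⟩) = j₂ ⟨Complex.exp x, hexF⟩) ∧
      (∀ V : Submodule ℚ K,
        Submodule.span ℚ ((fun x : F => j₁ x) '' {x : F | (x : ℂ) ∈ Submodule.span ℚ ({τ} : Set ℂ) ⊔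
            Submodule.span ℚ (range (Fin.append c e))}) ≤ V → V ≤ D →
        ((ldim (Submodule.span ℚ ((fun x : F => j₁ x) '' {x : F | (x : ℂ) ∈ Submodule.span ℚ ({τ} : Set ℂ) ⊔
            Submodule.span ℚ (range (Fin.append c e))})) V : ℕ) : ℕ∞) ≤
          (algMatroid K).relRank
            (↑(Submodule.span ℚ ((fun x : F => j₁ x) '' {x : F | (x : ℂ) ∈ Submodule.span ℚ ({τ} : Set ℂ) ⊔
              Submodule.span ℚ (range (Fin.append c e))})) ∪
              θ '' ↑(Submodule.span ℚ ((fun x : F => j₁ x) '' {x : F | (x : ℂ) ∈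
                Submodule.span ℚ ({τ} : Set ℂ) ⊔ Submodule.span ℚ (range (Fin.append c e))})))
            (↑V ∪ θ '' ↑V)) ∧
      (∀ (hcF : ∀ i, c i ∈ F) (heF : ∀ j, e j ∈ F) (q : Fin k → ℚ), q ≠ 0 →
        (∑ j, q j • (j₂ ⟨e j, heF j⟩ - j₁ ⟨e j, heF j⟩)) ∉
          Submodule.span ℚ ({t} : Set K) ⊔ Submodule.span ℚ (range fun i => j₁ ⟨c i, hcF i⟩)) := by
  sorry

/-- **Stub 4 — the double, model half (Bays–Kirby's countable model over the double base).**  From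
the data of Stub 3 — together with `δ(e/X) = 0` — there is an exponential field `M` (Bays–Kirby's
`M(F_base)`: `BKModel.exists_countable_seac_model` over `(K, D, θ, t)`, with embedding `ιM : K → M`,
`exp ∘ ιM = ιM ∘ θ` on `D`, kernel `ιM(t)ℤ`, `span (ιM '' D) ◁ M`) with kernel `τ₁ℤ`, an isomorphism
`σ₀ : ℚ^{ab}(τ₁) ≅ ℚ^{ab}(τ)` of base Γ-fields, and tuples `c₁ = ιM j₁ c`, `e₁ = ιM j₁ e`,
`e₂ = ιM j₂ e` such that both `(c₁, e₁)` and `(c₁, e₂)` are Γ-isomorphic over `σ₀` to `(c, e)`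
(`GammaField.isGammaIsoTw₂_of_ringHom` through `(ιM ∘ jᵢ)⁻¹`, the relevant generated subfields lying in
the range), `ℚτ₁ + ℚc₁ + ℚe₁ ◁ M` (from `span (ιM '' D) ◁ M` and the internal strongness clause of
Stub 3, via submodularity `predim_sup_le` and invariance of algebraic rank under `ιM`),
`δ(e₂ / ℚτ₁ + ℚc₁ + ℚe₁) = 0` (`≥ 0` as before, `≤ 0` from `δ(e/X) = 0` transported by `ιM ∘ j₂`), and
the general-position clause transported by `ιM`.  Provable now (L/XL). -/
theorem stub_doubleModel (τ : ℂ) {N k : ℕ} (c : Fin N → ℂ) (e : Fin k → ℂ)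
    (hlin : LinIndepOver (Submodule.span ℚ ({τ} : Set ℂ) ⊔ Submodule.span ℚ (range c)) e)
    (hδ : predim (Submodule.span ℚ ({τ} : Set ℂ) ⊔ Submodule.span ℚ (range c))
      (Submodule.span ℚ (range e)) = 0)
    (F : IntermediateField ℚ ℂ)
    (hFW : ∀ x ∈ Submodule.span ℚ ({τ} : Set ℂ) ⊔ Submodule.span ℚ (range (Fin.append c e)),
      x ∈ F ∧ ∀ M : ℕ, Complex.exp (x / (M.factorial : ℂ)) ∈ F)
    (K : Type) [Field K] [CharZero K] (D : Submodule ℚ K) (θ : K → K) (t : K) (j₁ j₂ : F →+* K)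
    (hK : IsStdKernelPartialExpField K D θ t)
    (hjτ : ∀ hτF : τ ∈ F, j₁ ⟨τ, hτF⟩ = t ∧ j₂ ⟨τ, hτF⟩ = t)
    (hagree : ∀ (x : ℂ) (hxF : x ∈ F),
      (x ∈ Submodule.span ℚ ({τ} : Set ℂ) ⊔ Submodule.span ℚ (range c) ∨
        ∃ y ∈ Submodule.span ℚ ({τ} : Set ℂ) ⊔ Submodule.span ℚ (range c), ∃ M : ℕ,
          x = Complex.exp (y / (M.factorial : ℂ))) →
      j₁ ⟨x, hxF⟩ = j₂ ⟨x, hxF⟩)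
    (hD : D = Submodule.span ℚ
      ((fun x : F => j₁ x) '' {x : F | (x : ℂ) ∈ Submodule.span ℚ ({τ} : Set ℂ) ⊔
          Submodule.span ℚ (range (Fin.append c e))} ∪
        (fun x : F => j₂ x) '' {x : F | (x : ℂ) ∈ Submodule.span ℚ ({τ} : Set ℂ) ⊔
          Submodule.span ℚ (range (Fin.append c e))}))
    (hθ : ∀ (x : ℂ) (hxF : x ∈ F) (hexF : Complex.exp x ∈ F),
      x ∈ Submodule.span ℚ ({τ} : Set ℂ) ⊔ Submodule.span ℚ (range (Fin.append c e)) →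
      θ (j₁ ⟨x, hxF⟩) = j₁ ⟨Complex.exp x, hexF⟩ ∧ θ (j₂ ⟨x, hxF⟩) = j₂ ⟨Complex.exp x, hexF⟩)
    (hstrong : ∀ V : Submodule ℚ K,
      Submodule.span ℚ ((fun x : F => j₁ x) '' {x : F | (x : ℂ) ∈ Submodule.span ℚ ({τ} : Set ℂ) ⊔
          Submodule.span ℚ (range (Fin.append c e))}) ≤ V → V ≤ D →
      ((ldim (Submodule.span ℚ ((fun x : F => j₁ x) '' {x : F | (x : ℂ) ∈ Submodule.span ℚ ({τ} : Set ℂ) ⊔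
          Submodule.span ℚ (range (Fin.append c e))})) V : ℕ) : ℕ∞) ≤
        (algMatroid K).relRank
          (↑(Submodule.span ℚ ((fun x : F => j₁ x) '' {x : F | (x : ℂ) ∈ Submodule.span ℚ ({τ} : Set ℂ) ⊔
            Submodule.span ℚ (range (Fin.append c e))})) ∪
            θ '' ↑(Submodule.span ℚ ((fun x : F => j₁ x) '' {x : F | (x : ℂ) ∈
              Submodule.span ℚ ({τ} : Set ℂ) ⊔ Submodule.span ℚ (range (Fin.append c e))})))
          (↑V ∪ θ '' ↑V))
    (hnov : ∀ (hcF : ∀ i, c i ∈ F) (heF : ∀ j, e j ∈ F) (q : Fin k → ℚ), q ≠ 0 →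
      (∑ j, q j • (j₂ ⟨e j, heF j⟩ - j₁ ⟨e j, heF j⟩)) ∉
        Submodule.span ℚ ({t} : Set K) ⊔ Submodule.span ℚ (range fun i => j₁ ⟨c i, hcF i⟩)) :
    ∃ (M : Type) (_ : Field M) (_ : CharZero M) (_ : ExponentialRing M) (τ₁ : M)
      (σ₀ : fieldOf (Submodule.span ℚ ({τ₁} : Set M)) ≃+*
        fieldOf (Submodule.span ℚ ({τ} : Set ℂ)))
      (c₁ : Fin N → M) (e₁ e₂ : Fin k → M),
      expKernel M = AddSubgroup.zmultiples τ₁ ∧ τ₁ ≠ 0 ∧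
      IsEBaseIso₂ (Submodule.span ℚ ({τ₁} : Set M))
        (Submodule.span ℚ ({τ} : Set ℂ)) σ₀ ∧
      IsGammaIsoTw₂ σ₀ (Fin.append c₁ e₁) (Fin.append c e) ∧
      IsGammaIsoTw₂ σ₀ (Fin.append c₁ e₂) (Fin.append c e) ∧
      IsStrong (Submodule.span ℚ ({τ₁} : Set M) ⊔ Submodule.span ℚ (range (Fin.append c₁ e₁))) ∧
      predim (Submodule.span ℚ ({τ₁} : Set M) ⊔ Submodule.span ℚ (range (Fin.append c₁ e₁)))
        (Submodule.span ℚ (range e₂)) = 0 ∧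
      ∀ q : Fin k → ℚ, q ≠ 0 →
        (∑ j, q j • (e₂ j - e₁ j)) ∉ Submodule.span ℚ ({τ₁} : Set M) ⊔ Submodule.span ℚ (range c₁) := by
  sorry

/-- **Stub 5 — realising the abstract copy in `ℂ` (cross-field saturation + composition).**  In the
situation produced by Stub 4, if `ℂ_exp` is a Zilber field then the second copy `e₂` is realised in
`ℂ` over `(c, e)`: there is `e'` with `(c, e) ↦ (c, e')` a Γ-isomorphism over the identity of
`ℚ^{ab}(2πi)`, `ℚ·2πi + ℚc + ℚe' ◁ ℂ`, and `Σ qⱼ(e'ⱼ − eⱼ) ∉ ℚ·2πi + ℚc` for `q ≠ 0`.  Provable now (L):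
`ZilberSaturationLog.isGammaIsoTw₂_saturation_tau'` with `F₁ = M`, `F₂ = ℂ` (algebraically closed,
`isSurjectiveOntoUnits_complex`, SEAC from `hZ`), base point `(c₁, e₁) ↦ (c, e)` and extension `e₂`
gives `E'`; `IsGammaIsoTw₂.comp` (sub-tuple `(c₁, e₂) ↦ (c, E')`), `.symm`, `.trans₂` with the second
copy's Γ-isomorphism and `σ₀.symm.trans σ₀ = refl` give `(c, e) ↦ (c, E')`; strongness of
`X + ℚE'` from `hX` by `IsStrong.of_predim_eq_zero` (`δ` is a Γ-isomorphism invariant,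
`IsGammaIsoTw₂.td_sup_span_eq`, and `hδe`); the general-position clause transports along the big
Γ-isomorphism (`ℚ`-linear relations with a `2πi`-term are level-0 polynomial relations over the base;
`σ₀ τ₁ = ±2πi` by `IsEBaseIso₂`). -/
theorem stub_realiseCopy (hZ : IsZilberField ℂ) (τ : ℂ) (hτ : τ = 2 * ↑Real.pi * Complex.I)
    (M : Type) [Field M] [CharZero M] [ExponentialRing M] (τ₁ : M)
    (hker : expKernel M = AddSubgroup.zmultiples τ₁) (hτ₁ : τ₁ ≠ 0)
    (σ₀ : fieldOf (Submodule.span ℚ ({τ₁} : Set M)) ≃+*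
      fieldOf (Submodule.span ℚ ({τ} : Set ℂ)))
    (hσ₀ : IsEBaseIso₂ (Submodule.span ℚ ({τ₁} : Set M))
      (Submodule.span ℚ ({τ} : Set ℂ)) σ₀)
    {N k : ℕ} (c₁ : Fin N → M) (e₁ e₂ : Fin k → M) (c : Fin N → ℂ) (e : Fin k → ℂ)
    (h₁ : IsGammaIsoTw₂ σ₀ (Fin.append c₁ e₁) (Fin.append c e))
    (h₂ : IsGammaIsoTw₂ σ₀ (Fin.append c₁ e₂) (Fin.append c e))
    (hsM : IsStrong (Submodule.span ℚ ({τ₁} : Set M) ⊔ Submodule.span ℚ (range (Fin.append c₁ e₁))))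
    (hδM : predim (Submodule.span ℚ ({τ₁} : Set M) ⊔ Submodule.span ℚ (range (Fin.append c₁ e₁)))
      (Submodule.span ℚ (range e₂)) = 0)
    (hnew : ∀ q : Fin k → ℚ, q ≠ 0 →
      (∑ j, q j • (e₂ j - e₁ j)) ∉ Submodule.span ℚ ({τ₁} : Set M) ⊔ Submodule.span ℚ (range c₁))
    (hX : IsStrong (Submodule.span ℚ ({τ} : Set ℂ) ⊔ Submodule.span ℚ (range c)))
    (hXe : IsStrong (Submodule.span ℚ ({τ} : Set ℂ) ⊔
      Submodule.span ℚ (range (Fin.append c e))))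
    (hδe : predim (Submodule.span ℚ ({τ} : Set ℂ) ⊔ Submodule.span ℚ (range c))
      (Submodule.span ℚ (range e)) = 0) :
    ∃ e' : Fin k → ℂ,
      IsGammaIsoTw₂ (RingEquiv.refl (fieldOf (Submodule.span ℚ ({τ} : Set ℂ))))
        (Fin.append c e) (Fin.append c e') ∧
      IsStrong (Submodule.span ℚ ({τ} : Set ℂ) ⊔
        Submodule.span ℚ (range (Fin.append c e'))) ∧
      ∀ q : Fin k → ℚ, q ≠ 0 →
        (∑ j, q j • (e' j - e j)) ∉
          Submodule.span ℚ ({τ} : Set ℂ) ⊔ Submodule.span ℚ (range c) := by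
  sorry

/-- **Stub 6 — Case I: core-fixed elements are ELA (doubling ⟹ genericity).**  Under Zilber's
conjecture, granted hull-to-core (`hH2C`, proved below from the tree) and the doubling principle
(`hD` = Stubs 3+4+5), every element of `ecl ∅` fixed by all exponential-field automorphisms of
`C₀ = ecl ∅` lies in the ELA-core `C_ELA` = the smallest subfield of `ℂ` containing `2πi` which is
closed under `exp`, relatively algebraically closed, and closed under logarithms.  Provable now (L):
Schanuel (`hZ.schanuelProperty`, `schanuelProperty_iff_isStrong_span_kernelGenerator`) makes `Λ₀ = ℚ·2πi`
strong; take a hull `W ∋ a` with `δ(W/Λ₀) = 0`, `W ◁ ℂ`, inside `span (ecl ∅)`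
(`exists_predim_eq_zero_of_mem_ecl_of_isStrong` / `IsStrong.exists_isStrong_of_le`, `isStrong_span_ecl`,
`ax_schanuel_holds`); let `U*` be the closure of `Λ₀` inside `W` under "`v ∈ W` algebraic over
`ℚ(gens U)`" and "`v ∈ W` with `exp v` algebraic over `ℚ(gens U)`" (finite-dimensional induction; each
step has `δ = 0`, so `U* ◁ ℂ`, `δ(W/U*) = 0`, and `U* ⊆ C_ELA` by the closure properties of `C_ELA`);
`W` is free over `U*` by maximality; if `a ∉ U*` write `a = u + Σ qⱼ eⱼ` (`e` a basis of `W` mod `U*`,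
`q ≠ 0`), get `e'` from `hD` and `g` from `hH2C` with `g = id` on `U*`, `g eⱼ = e'ⱼ`; `g` is `ℚ`-linear on
`ecl ∅ ⊇ W`, so `g a − a = Σ qⱼ(e'ⱼ − eⱼ) ∉ U* ∋ 0` — contradiction with `g a = a`. -/
theorem stub_caseI (hZ : IsZilberField ℂ) (τ : ℂ) (hτ : τ = 2 * ↑Real.pi * Complex.I)
    (hH2C : ∀ {N : ℕ} {c c' : Fin N → ℂ},
      IsGammaIsoTw₂ (RingEquiv.refl (fieldOf (Submodule.span ℚ ({τ} : Set ℂ)))) c c' →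
      IsStrong (Submodule.span ℚ ({τ} : Set ℂ) ⊔ Submodule.span ℚ (range c)) →
      IsStrong (Submodule.span ℚ ({τ} : Set ℂ) ⊔ Submodule.span ℚ (range c')) →
      ∃ g : ℂ → ℂ, IsEIsoOn g (ecl (∅ : Set ℂ)) (ecl (∅ : Set ℂ)) ∧ ∀ j, g (c j) = c' j)
    (hD : ∀ {N k : ℕ} (c : Fin N → ℂ) (e : Fin k → ℂ),
      IsStrong (Submodule.span ℚ ({τ} : Set ℂ) ⊔ Submodule.span ℚ (range c)) →
      IsStrong (Submodule.span ℚ ({τ} : Set ℂ) ⊔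
        Submodule.span ℚ (range (Fin.append c e))) →
      LinIndepOver (Submodule.span ℚ ({τ} : Set ℂ) ⊔ Submodule.span ℚ (range c)) e →
      predim (Submodule.span ℚ ({τ} : Set ℂ) ⊔ Submodule.span ℚ (range c))
        (Submodule.span ℚ (range e)) = 0 →
      (∀ m : Fin k → ℤ, m ≠ 0 →
        (∑ j, (m j : ℚ) • e j) ∉ acl (gens (Submodule.span ℚ ({τ} : Set ℂ) ⊔
          Submodule.span ℚ (range c))) ∧
        Complex.exp (∑ j, (m j : ℚ) • e j) ∉ acl (gens (Submodule.span ℚ ({τ} : Set ℂ) ⊔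
          Submodule.span ℚ (range c)))) →
      ∃ e' : Fin k → ℂ,
        IsGammaIsoTw₂ (RingEquiv.refl (fieldOf (Submodule.span ℚ ({τ} : Set ℂ))))
          (Fin.append c e) (Fin.append c e') ∧
        IsStrong (Submodule.span ℚ ({τ} : Set ℂ) ⊔
          Submodule.span ℚ (range (Fin.append c e'))) ∧
        ∀ q : Fin k → ℚ, q ≠ 0 →
          (∑ j, q j • (e' j - e j)) ∉
            Submodule.span ℚ ({τ} : Set ℂ) ⊔ Submodule.span ℚ (range c)) :
    ∀ a ∈ ecl (∅ : Set ℂ),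
      (∀ g : ℂ → ℂ, IsEIsoOn g (ecl (∅ : Set ℂ)) (ecl (∅ : Set ℂ)) → g a = a) →
        a ∈ (sInf {K : IntermediateField ℚ ℂ | (2 * ↑Real.pi * Complex.I : ℂ) ∈ K ∧
          (∀ w ∈ K, Complex.exp w ∈ K) ∧ (∀ w : ℂ, IsAlgebraic K w → w ∈ K) ∧
          (∀ w : ℂ, Complex.exp w ∈ K → w ∈ K)} : IntermediateField ℚ ℂ) := by
  sorry

/-- **Stub 7 — Case II: ELA core-fixed elements are log-free (the arithmetic residue; HARDEST,
held by the lead).**  Under Zilber's conjecture, granted hull-to-core and the log-shift principle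
(Stub 2), an element of the ELA-core `C_ELA ∩ ecl ∅` fixed by every exponential-field automorphism of
`C₀ = ecl ∅` lies in the log-free core `C_EA = logFreeCore`.  Route: an element of `C_ELA` sits in a
strong E/L/A-chain `Λ₀ ⊂ S₁ ⊂ ⋯ ⊂ Sₙ` (`δ = 0` steps: A = algebraic over the previous Γ-field, L =
logarithm of such); induction on `n` for the statement "core-fixed ∩ `acl (gens Sₙ)` ⊆ `C_EA`": an
L-step `s` is killed by the log shifts `s ↦ s + m j·2πi` (`hLS` + `hH2C`: infinitely many automorphisms
fixing `Sₙ₋₁` pointwise; a polynomial relation `P(s + m j·2πi, x) = 0` for infinitely many `j` forces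
`x ∈ acl (gens Sₙ₋₁)`); an A-step `s` with `s` itself core-fixed is absorbed into the log-free base by
the induction hypothesis; the A-step with `s` moved (`y = exp s` transversality) is the open point.
Why it might fail / price: contains "`e^{π√2}·…`-type" independence bookkeeping over `C_EA`; it is
implied by Zilber's conjecture + Kirby's free-amalgamation calculus for `SK^{ELA}` (FPEF §6), nowhere
in print. -/
theorem stub_caseII (hZ : IsZilberField ℂ) (τ : ℂ) (hτ : τ = 2 * ↑Real.pi * Complex.I)
    (hH2C : ∀ {N : ℕ} {c c' : Fin N → ℂ},
      IsGammaIsoTw₂ (RingEquiv.refl (fieldOf (Submodule.span ℚ ({τ} : Set ℂ)))) c c' →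
      IsStrong (Submodule.span ℚ ({τ} : Set ℂ) ⊔ Submodule.span ℚ (range c)) →
      IsStrong (Submodule.span ℚ ({τ} : Set ℂ) ⊔ Submodule.span ℚ (range c')) →
      ∃ g : ℂ → ℂ, IsEIsoOn g (ecl (∅ : Set ℂ)) (ecl (∅ : Set ℂ)) ∧ ∀ j, g (c j) = c' j)
    (hLS : ∀ {N : ℕ} (c : Fin N → ℂ) (d : ℂ),
      Complex.exp d ∈ acl (gens (Submodule.span ℚ ({τ} : Set ℂ) ⊔
        Submodule.span ℚ (range c))) →
      d ∉ acl (gens (Submodule.span ℚ ({τ} : Set ℂ) ⊔ Submodule.span ℚ (range c))) →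
      ∃ m : ℕ, 0 < m ∧ ∀ j : ℤ,
        IsGammaIsoTw₂ (RingEquiv.refl (fieldOf (Submodule.span ℚ ({τ} : Set ℂ))))
          (Fin.snoc c d) (Fin.snoc c (d + (m : ℂ) * (j : ℂ) * τ))) :
    ∀ a ∈ ecl (∅ : Set ℂ),
      a ∈ (sInf {K : IntermediateField ℚ ℂ | (2 * ↑Real.pi * Complex.I : ℂ) ∈ K ∧
          (∀ w ∈ K, Complex.exp w ∈ K) ∧ (∀ w : ℂ, IsAlgebraic K w → w ∈ K) ∧
          (∀ w : ℂ, Complex.exp w ∈ K → w ∈ K)} : IntermediateField ℚ ℂ) →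
      (∀ g : ℂ → ℂ, IsEIsoOn g (ecl (∅ : Set ℂ)) (ecl (∅ : Set ℂ)) → g a = a) →
        a ∈ (logFreeCore : Set ℂ) := by
  sorry

/-! ## Closed stubs of the original skeleton (landed by lead -0), kept for the record -/

/-- `acl(∅) ⊆ ecl(∅)` under EAC — CLOSED (p71976). -/
theorem aclSubsetEcl_of_eac : IsExpAlgClosed ℂ → expAcl ⊆ ecl (∅ : Set ℂ) :=
  Summit.Schanuel.Schanuel.Theorems.RigidCore.stub_aclSubsetEcl_of_eac

/-- Core automorphisms are elementary for `∅`-definable sets under EAC — CLOSED (p72100). -/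
theorem coreAut_elementary_of_eac :
    IsExpAlgClosed ℂ →
      ∀ g : ℂ → ℂ, IsEIsoOn g (ecl (∅ : Set ℂ)) (ecl (∅ : Set ℂ)) →
        ∀ s : Set ℂ, Set.Definable₁ (∅ : Set ℂ) Language.expRing s →
          ∀ a ∈ ecl (∅ : Set ℂ), (a ∈ s ↔ g a ∈ s) :=
  Summit.Schanuel.Schanuel.Theorems.RigidCore.stub_coreAut_elementary_of_eac

/-! ## Glue (sorry-free) -/

/-- The kernel of the complex exponential is `2πiℤ` (tree vocabulary). -/
theorem expKernel_complex_eq_zmultiples :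
    expKernel ℂ = AddSubgroup.zmultiples (2 * ↑Real.pi * Complex.I : ℂ) := by
  ext x
  rw [mem_expKernel_complex_iff, AddSubgroup.mem_zmultiples_iff]
  constructor
  · rintro ⟨n, hn⟩
    exact ⟨n, by rw [hn, zsmul_eq_mul]⟩
  · rintro ⟨n, rfl⟩
    exact ⟨n, by rw [zsmul_eq_mul]⟩

/-- `2πi ≠ 0`. -/
theorem two_pi_I_ne_zero : (2 * ↑Real.pi * Complex.I : ℂ) ≠ 0 := by
  have hπ : (Real.pi : ℂ) ≠ 0 := Complex.ofReal_ne_zero.2 Real.pi_ne_zero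
  simp [hπ, Complex.I_ne_zero]

/-- **Hull-to-core** (proved; = `Theorems/RigidCoreAclSubsetLogFreeCoreHullToCore.lean` once landed):
under Zilber's conjecture a Γ-isomorphism over the identity of `ℚ^{ab}(2πi)` between strong tuples is
realised by an exponential-field automorphism of `ecl ∅` (`ZilberAutomorphisms.exists_isEIsoOn_of_isGammaIsoTw₂`
restricted to the prime closure, `IsEIsoOn.restrict`). -/
theorem hullToCore (hZ : IsZilberField ℂ) (τ : ℂ) (hτ : τ = 2 * ↑Real.pi * Complex.I) {N : ℕ} {c c' : Fin N → ℂ}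
    (hiso : IsGammaIsoTw₂
      (RingEquiv.refl (fieldOf (Submodule.span ℚ ({τ} : Set ℂ)))) c c')
    (hs : IsStrong (Submodule.span ℚ ({τ} : Set ℂ) ⊔ Submodule.span ℚ (range c)))
    (hs' : IsStrong (Submodule.span ℚ ({τ} : Set ℂ) ⊔ Submodule.span ℚ (range c'))) :
    ∃ g : ℂ → ℂ, IsEIsoOn g (ecl (∅ : Set ℂ)) (ecl (∅ : Set ℂ)) ∧ ∀ j, g (c j) = c' j := by
  subst hτ
  obtain ⟨g, hg, hgc, -⟩ := ZilberAutomorphisms.exists_isEIsoOn_of_isGammaIsoTw₂ hZ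
    expKernel_complex_eq_zmultiples expKernel_complex_eq_zmultiples two_pi_I_ne_zero
    two_pi_I_ne_zero (IsEBaseIso₂.refl _) hiso hs hs'
  have h0 := hg.restrict (Set.empty_subset _)
  rw [Set.image_empty] at h0
  exact ⟨g, h0, hgc⟩

/-- **The doubling principle** (Stubs 3 + 4 + 5: base, model, realisation): under Zilber's conjecture a free strong extension
`e` of `X = ℚ·2πi + ℚc ◁ ℂ` of predimension `0` has a Γ-isomorphic partner `e'` over `c` (identity on
the base), again strong, in general position with respect to `e` modulo `X`. -/
theorem doubling (hZ : IsZilberField ℂ) (τ : ℂ) (hτ : τ = 2 * ↑Real.pi * Complex.I) {N k : ℕ} (c : Fin N → ℂ) (e : Fin k → ℂ)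
    (hX : IsStrong (Submodule.span ℚ ({τ} : Set ℂ) ⊔ Submodule.span ℚ (range c)))
    (hW : IsStrong (Submodule.span ℚ ({τ} : Set ℂ) ⊔
      Submodule.span ℚ (range (Fin.append c e))))
    (hlin : LinIndepOver (Submodule.span ℚ ({τ} : Set ℂ) ⊔
      Submodule.span ℚ (range c)) e)
    (hδ : predim (Submodule.span ℚ ({τ} : Set ℂ) ⊔ Submodule.span ℚ (range c))
      (Submodule.span ℚ (range e)) = 0)
    (hfree : ∀ m : Fin k → ℤ, m ≠ 0 →
      (∑ j, (m j : ℚ) • e j) ∉ acl (gens (Submodule.span ℚ ({τ} : Set ℂ) ⊔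
        Submodule.span ℚ (range c))) ∧
      Complex.exp (∑ j, (m j : ℚ) • e j) ∉ acl (gens (Submodule.span ℚ ({τ} : Set ℂ) ⊔
        Submodule.span ℚ (range c)))) :
    ∃ e' : Fin k → ℂ,
      IsGammaIsoTw₂ (RingEquiv.refl (fieldOf (Submodule.span ℚ ({τ} : Set ℂ))))
        (Fin.append c e) (Fin.append c e') ∧
      IsStrong (Submodule.span ℚ ({τ} : Set ℂ) ⊔
        Submodule.span ℚ (range (Fin.append c e'))) ∧
      ∀ q : Fin k → ℚ, q ≠ 0 →
        (∑ j, q j • (e' j - e j)) ∉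
          Submodule.span ℚ ({τ} : Set ℂ) ⊔ Submodule.span ℚ (range c) := by
  obtain ⟨F, hFW, K, _, _, D, θ, t, j₁, j₂, hK, hjτ, hagree, hD, hθ, hstrong, hnov⟩ :=
    stub_doubleBase τ hτ c e hX hlin hfree
  obtain ⟨M, _, _, _, τ₁, σ₀, c₁, e₁, e₂, hker, hτ₁, hσ₀, h₁, h₂, hsM, hδM, hnew⟩ :=
    stub_doubleModel τ c e hlin hδ F hFW K D θ t j₁ j₂ hK hjτ hagree hD hθ hstrong hnov
  exact stub_realiseCopy hZ τ hτ M τ₁ hker hτ₁ σ₀ hσ₀ c₁ e₁ e₂ c e h₁ h₂ hsM hδM hnew hX hW hδ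

/-- **The residue (A₀) under Zilber's conjecture** (Case I + Case II): the fixed field of
`Aut_E(ecl ∅)` lies in the log-free core. -/
theorem coreFixedField_logFree_of_zilber (hZ : IsZilberField ℂ) (τ : ℂ) (hτ : τ = 2 * ↑Real.pi * Complex.I) :
    ∀ a ∈ ecl (∅ : Set ℂ),
      (∀ g : ℂ → ℂ, IsEIsoOn g (ecl (∅ : Set ℂ)) (ecl (∅ : Set ℂ)) → g a = a) →
        a ∈ (logFreeCore : Set ℂ) :=
  fun a ha hfix =>
    stub_caseII hZ τ hτ (fun hiso hs hs' => hullToCore hZ τ hτ hiso hs hs')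
      (fun c d => stub_logShift τ hτ c d) a ha
      (stub_caseI hZ τ hτ (fun hiso hs hs' => hullToCore hZ τ hτ hiso hs hs')
        (fun c e => doubling hZ τ hτ c e) a ha hfix)
      hfix

/-- The residue stub of the ORIGINAL skeleton, now a consequence of the reshaped stubs. -/
theorem stub_coreFixedField_logFree_of_stubs :
    ∀ a ∈ ecl (∅ : Set ℂ),
      (∀ g : ℂ → ℂ, IsEIsoOn g (ecl (∅ : Set ℂ)) (ecl (∅ : Set ℂ)) → g a = a) →
        a ∈ (logFreeCore : Set ℂ) :=
  coreFixedField_logFree_of_zilber stub_zilber (2 * ↑Real.pi * Complex.I) rfl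

/-! ## The composition: the crux BY NAME -/

/-- **`AclSubsetLogFreeCore_of` — THE SKELETON THEOREM**: the crux `RigidCore.AclSubsetLogFreeCore`
BY NAME, from the registered stubs through the landed transfer theorem
`aclSubsetLogFreeCore_of_eac_of_coreFixedField` (p72771: (A) ⟸ EAC ∧ (A₀)); EAC is
`stub_zilber.isStronglyExpAlgClosed.isExpAlgClosed`, (A₀) is `coreFixedField_logFree_of_zilber`. -/
theorem AclSubsetLogFreeCore_of :
    Summit.Schanuel.Schanuel.Theses.RigidCore.AclSubsetLogFreeCore :=
  Summit.Schanuel.Schanuel.Theorems.RigidCore.aclSubsetLogFreeCore_of_eac_of_coreFixedField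
    stub_zilber.isStronglyExpAlgClosed.isExpAlgClosed
    (coreFixedField_logFree_of_zilber stub_zilber (2 * ↑Real.pi * Complex.I) rfl)

end Summit.Schanuel.Schanuel.Cruxes.AclSubsetLogFreeCore.EacExtendsCoreAutomorphisms
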